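import Mathlib
import Literature.MathematicalPhysics.StatisticalMechanics.Crystallization

/-!
# Crux `ExactCertificate` (stmt-AtomisticToContinuum-11959), line `closure-makes-nogap-exact`,
# Transfer skeleton II (`…Cruxes.ExactCertificate.Transfer1D.Crystallization1D`) — stub `stub_ljMidpointConvex`:
# one-variable midpoint convexity of the Lennard-Jones potential

Support file (`--supports stmt-AtomisticToContinuum-11959`); nothing here closes the 3-D crux.

The positional crystallization of the Lennard-Jones CHAIN (`IsCrystallizing lennardJones 1`, skeleton
`Crystallization1D`) uses that the line energy is uniformly convex in the nearest-neighbour gaps on the box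
`[3/4, 1]`.  This file supplies the two one-variable ingredients, in derivative-free (midpoint) form, for
`V = lennardJones`, `V(r) = (1/12) r⁻¹² − (1/6) r⁻⁶`:

* (i) STRONG midpoint convexity with modulus `6` on `[3/4, 1]`: for `s, t ∈ [3/4, 1]`,
  `V((s+t)/2) ≤ (V s + V t)/2 − (3/4)(s − t)²`;
* (ii) midpoint SEMI-convexity with modulus `7R⁻⁸` on `[R, ∞)`, `R > 0`: for `s, t ≥ R`,
  `V((s+t)/2) ≤ (V s + V t)/2 + (7/8) R⁻⁸ (s − t)²`.

Proof: `V′(r) = −r⁻¹³ + r⁻⁷`, `V″(r) = 13 r⁻¹⁴ − 7 r⁻⁸` (`r ≠ 0`).  (i) For `r ∈ [3/4, 1]`,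
`u := r⁻¹ ≥ 1`, so `V″ − 6 = 13u¹⁴ − 7u⁸ − 6 ≥ 13u⁸ − 7u⁸ − 6 = 6(u⁸ − 1) ≥ 0`; hence
`g(r) = V(r) − 3r²` is convex on `[3/4, 1]` (`convexOn_of_hasDerivWithinAt2_nonneg`) and its midpoint
convexity is (i), because `(s² + t²)/2 − ((s+t)/2)² = (s − t)²/4`.  (ii) For `r ≥ R > 0`, `r⁻⁸ ≤ R⁻⁸`,
so `V″ + 7R⁻⁸ ≥ 0` and `h(r) = V(r) + (7/2)R⁻⁸ r²` is convex on `[R, ∞)`; its midpoint convexity is (ii)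
(`(7/2)·¼ = 7/8`).
-/

noncomputable section

namespace Summit.AtomisticToContinuum.Crystallization.Theorems.ThreeConeCertificateExactCertificate.Transfer1D

open Literature.MathematicalPhysics.StatisticalMechanics Set

/-! ## Derivatives of `r ↦ r⁻ⁿ` and of `V_LJ` -/

/-- `d/dr (r⁻¹)ⁿ = −n (r⁻¹)ⁿ⁺¹` for `r ≠ 0`. [folklore] -/
theorem ljConvex_hasDerivAt_inv_pow (n : ℕ) {r : ℝ} (hr : r ≠ 0) :
    HasDerivAt (fun x : ℝ => x⁻¹ ^ n) (-(n : ℝ) * r⁻¹ ^ (n + 1)) r := by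
  refine ((hasDerivAt_inv hr).fun_pow n).congr_deriv ?_
  cases n with
  | zero => simp
  | succ k =>
    rw [Nat.add_sub_cancel, ← inv_pow]
    push_cast
    ring

/-- `V_LJ′(r) = −r⁻¹³ + r⁻⁷` for `r ≠ 0`. [folklore] -/
theorem ljConvex_hasDerivAt_lennardJones {r : ℝ} (hr : r ≠ 0) :
    HasDerivAt lennardJones (-(r⁻¹ ^ 13) + r⁻¹ ^ 7) r := by
  have hfun : lennardJones = fun y : ℝ => (1 / 12 : ℝ) * y⁻¹ ^ 12 - (1 / 6 : ℝ) * y⁻¹ ^ 6 := by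
    funext y; simp [lennardJones]
  rw [hfun]
  refine (((ljConvex_hasDerivAt_inv_pow 12 hr).const_mul (1 / 12 : ℝ)).fun_sub
    ((ljConvex_hasDerivAt_inv_pow 6 hr).const_mul (1 / 6 : ℝ))).congr_deriv ?_
  push_cast
  ring

/-- `d/dr (V_LJ(r) + c r²) = −r⁻¹³ + r⁻⁷ + 2cr` for `r ≠ 0`. [folklore] -/
theorem ljConvex_hasDerivAt_add_sq (c : ℝ) {r : ℝ} (hr : r ≠ 0) :
    HasDerivAt (fun x : ℝ => lennardJones x + c * x ^ 2)
      (-(r⁻¹ ^ 13) + r⁻¹ ^ 7 + 2 * c * r) r := by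
  refine ((ljConvex_hasDerivAt_lennardJones hr).fun_add
    ((hasDerivAt_pow 2 r).const_mul c)).congr_deriv ?_
  simp only [Nat.cast_ofNat, Nat.add_one_sub_one, pow_one]
  ring

/-- `d/dr (−r⁻¹³ + r⁻⁷ + 2cr) = 13 r⁻¹⁴ − 7 r⁻⁸ + 2c` for `r ≠ 0` (so `V_LJ″ = 13 r⁻¹⁴ − 7 r⁻⁸`).
[folklore] -/
theorem ljConvex_hasDerivAt_deriv (c : ℝ) {r : ℝ} (hr : r ≠ 0) :
    HasDerivAt (fun x : ℝ => -(x⁻¹ ^ 13) + x⁻¹ ^ 7 + 2 * c * x)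
      (13 * r⁻¹ ^ 14 - 7 * r⁻¹ ^ 8 + 2 * c) r := by
  refine ((((ljConvex_hasDerivAt_inv_pow 13 hr).fun_neg).fun_add
    (ljConvex_hasDerivAt_inv_pow 7 hr)).fun_add ((hasDerivAt_id' r).const_mul (2 * c))).congr_deriv ?_
  push_cast
  ring

/-! ## Convexity of `V_LJ + c r²` from the sign of `V_LJ″ + 2c`, and the midpoint form -/

/-- If `D ⊆ (0, ∞)` is convex and `13 r⁻¹⁴ − 7 r⁻⁸ + 2c ≥ 0` on `D`, then `r ↦ V_LJ(r) + c r²` is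
convex on `D` (second-derivative test). [folklore] -/
theorem ljConvex_convexOn_add_sq {D : Set ℝ} (hD : Convex ℝ D) (hD0 : ∀ r ∈ D, 0 < r) (c : ℝ)
    (hc : ∀ r ∈ D, 0 ≤ 13 * r⁻¹ ^ 14 - 7 * r⁻¹ ^ 8 + 2 * c) :
    ConvexOn ℝ D (fun r => lennardJones r + c * r ^ 2) := by
  refine convexOn_of_hasDerivWithinAt2_nonneg hD (f' := fun r => -(r⁻¹ ^ 13) + r⁻¹ ^ 7 + 2 * c * r)
    (f'' := fun r => 13 * r⁻¹ ^ 14 - 7 * r⁻¹ ^ 8 + 2 * c) ?_ ?_ ?_ ?_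
  · intro r hr
    exact (ljConvex_hasDerivAt_add_sq c (hD0 r hr).ne').continuousAt.continuousWithinAt
  · intro r hr
    exact (ljConvex_hasDerivAt_add_sq c (hD0 r (interior_subset hr)).ne').hasDerivWithinAt
  · intro r hr
    exact (ljConvex_hasDerivAt_deriv c (hD0 r (interior_subset hr)).ne').hasDerivWithinAt
  · intro r hr
    exact hc r (interior_subset hr)

/-- Midpoint form of the convexity of `f + c r²`: `f((s+t)/2) ≤ (f s + f t)/2 + (c/4)(s − t)²`, since
`(s² + t²)/2 − ((s+t)/2)² = (s − t)²/4`. [folklore] -/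
theorem ljConvex_midpoint_of_convexOn {D : Set ℝ} {f : ℝ → ℝ} {c : ℝ}
    (h : ConvexOn ℝ D (fun r => f r + c * r ^ 2)) {s t : ℝ} (hs : s ∈ D) (ht : t ∈ D) :
    f ((s + t) / 2) ≤ (f s + f t) / 2 + c / 4 * (s - t) ^ 2 := by
  have key := h.2 hs ht (by norm_num : (0 : ℝ) ≤ 1 / 2) (by norm_num : (0 : ℝ) ≤ 1 / 2)
    (by norm_num : (1 / 2 : ℝ) + 1 / 2 = 1)
  simp only [smul_eq_mul] at key
  have e : (1 / 2 : ℝ) * s + 1 / 2 * t = (s + t) / 2 := by ring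
  rw [e] at key
  linear_combination key

/-- `V_LJ″ ≥ 6` on `[3/4, 1]`: `13u¹⁴ − 7u⁸ − 6 ≥ 6(u⁸ − 1) ≥ 0` for `u = r⁻¹ ≥ 1`. [folklore] -/
theorem ljConvex_deriv2_ge_six {r : ℝ} (hr0 : 0 < r) (hr1 : r ≤ 1) :
    0 ≤ 13 * r⁻¹ ^ 14 - 7 * r⁻¹ ^ 8 + 2 * (-3) := by
  have hu : 1 ≤ r⁻¹ := (one_le_inv₀ hr0).2 hr1
  have h6 : (1 : ℝ) ≤ r⁻¹ ^ 6 := one_le_pow₀ hu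
  have h8 : (1 : ℝ) ≤ r⁻¹ ^ 8 := one_le_pow₀ hu
  have h14 : r⁻¹ ^ 8 ≤ r⁻¹ ^ 14 := by
    have := mul_le_mul_of_nonneg_left h6 (zero_le_one.trans h8)
    calc r⁻¹ ^ 8 = r⁻¹ ^ 8 * 1 := (mul_one _).symm
      _ ≤ r⁻¹ ^ 8 * r⁻¹ ^ 6 := this
      _ = r⁻¹ ^ 14 := by ring
  linarith

/-- `V_LJ″ + 7R⁻⁸ ≥ 0` on `[R, ∞)`, `R > 0`: `r⁻⁸ ≤ R⁻⁸` and `13 r⁻¹⁴ ≥ 0`. [folklore] -/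
theorem ljConvex_deriv2_ge_neg {R r : ℝ} (hR : 0 < R) (hRr : R ≤ r) :
    0 ≤ 13 * r⁻¹ ^ 14 - 7 * r⁻¹ ^ 8 + 2 * (7 / 2 * R⁻¹ ^ 8) := by
  have hr : 0 < r := hR.trans_le hRr
  have hinv : r⁻¹ ≤ R⁻¹ := (inv_le_inv₀ hr hR).2 hRr
  have h8 : r⁻¹ ^ 8 ≤ R⁻¹ ^ 8 := pow_le_pow_left₀ (inv_nonneg.2 hr.le) hinv 8
  have h14 : (0 : ℝ) ≤ r⁻¹ ^ 14 := by positivity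
  linarith

/-! ## The stub -/

/-- STUB (D1) `stub_ljMidpointConvex` — ONE-VARIABLE CONVEXITY OF `V_LJ`: strong midpoint convexity with modulus `6`
on `[3/4, 1]` (`V″(r) = 13r⁻¹⁴ − 7r⁻⁸ ≥ 6` for `3/4 ≤ r ≤ 1`) and midpoint semiconvexity with modulus `7R⁻⁸` on
`[R, ∞)` (`V″ ≥ −7r⁻⁸ ≥ −7R⁻⁸`), both via convexity of `V + c r²` and
`(s² + t²)/2 − ((s+t)/2)² = (s − t)²/4`. [folklore] -/
theorem stub_ljMidpointConvex :
    (∀ s t : ℝ, 3 / 4 ≤ s → s ≤ 1 → 3 / 4 ≤ t → t ≤ 1 →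
      lennardJones ((s + t) / 2) ≤ (lennardJones s + lennardJones t) / 2 - 3 / 4 * (s - t) ^ 2) ∧
    (∀ R s t : ℝ, 0 < R → R ≤ s → R ≤ t →
      lennardJones ((s + t) / 2) ≤ (lennardJones s + lennardJones t) / 2 + 7 / 8 * (R⁻¹) ^ 8 * (s - t) ^ 2) := by
  refine ⟨fun s t hs0 hs1 ht0 ht1 => ?_, fun R s t hR hRs hRt => ?_⟩
  · have hconv : ConvexOn ℝ (Icc (3 / 4 : ℝ) 1) (fun r => lennardJones r + (-3) * r ^ 2) :=
      ljConvex_convexOn_add_sq (convex_Icc _ _) (fun r hr => by linarith [hr.1]) (-3)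
        (fun r hr => ljConvex_deriv2_ge_six (by linarith [hr.1]) hr.2)
    have key := ljConvex_midpoint_of_convexOn hconv ⟨hs0, hs1⟩ ⟨ht0, ht1⟩
    linarith
  · have hconv : ConvexOn ℝ (Ici R) (fun r => lennardJones r + (7 / 2 * R⁻¹ ^ 8) * r ^ 2) :=
      ljConvex_convexOn_add_sq (convex_Ici _) (fun r hr => hR.trans_le hr) (7 / 2 * R⁻¹ ^ 8)
        (fun r hr => ljConvex_deriv2_ge_neg hR hr)
    have key :=
      ljConvex_midpoint_of_convexOn hconv (show s ∈ Ici R from hRs) (show t ∈ Ici R from hRt)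
    calc lennardJones ((s + t) / 2)
        ≤ (lennardJones s + lennardJones t) / 2 + 7 / 2 * R⁻¹ ^ 8 / 4 * (s - t) ^ 2 := key
      _ = (lennardJones s + lennardJones t) / 2 + 7 / 8 * (R⁻¹) ^ 8 * (s - t) ^ 2 := by ring

end Summit.AtomisticToContinuum.Crystallization.Theorems.ThreeConeCertificateExactCertificate.Transfer1D

end
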